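import Summits.HodgeConjecture.CorCM.GaloisTwentyFourDegenerateModels
import Summits.HodgeConjecture.CorCM.CyclicAsymmetricCMHalves
import HarnessLib

/-!
# A real BIQUADRATIC factor destroys nondegeneracy: `Gal(K/ℚ) ≅ H × C₂ × C₂` with `c ∈ H` — the DOUBLE PAIR SWAP
# and its four-point balanced set; `Q₈ × C₂²`, `Dic_N × C₂²` are BAD although `Dic_N × C₂` can be good

COR-CM (cell `pub-hodgecm2`), binder seat b04 (gen 23), count-neutral claim CYCLIC-BY-MULTIPLIERS, part VII — a
NON-skew mechanism in gen 20's balanced-set format (`GaloisModels.exists_simple_degenerate_of_model_balanced`).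
KERNEL ONLY: theorems; no definition, no named fact, no `sorry`.  `HC_CM` is neither used nor claimed.

SETTING.  `K/ℚ` Galois CM with `e : Gal(K/ℚ) ≃* H × V`, `V = C₂ × C₂ = {1, a, b, ab}`, `e(c) = (c₀, 1)` — i.e.
`K = K₁ L` with `K₁` Galois CM (group `H`, conjugation `c₀`) and `L` a totally real BIQUADRATIC field, `K₁ ∩ L = ℚ`.
A CM type of `K` is a family `(Ψ_v)_{v ∈ V}` of CM sets of `H`.  THE DOUBLE PAIR SWAP: from one CM set `Ψ` of `H` and
two of its points `p, q` in different `c₀`-pairs put `Ψ_1 = Ψ`, `Ψ_a = Ψ △ {p, c₀p}`, `Ψ_b = Ψ △ {q, c₀q}`,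
`Ψ_{ab} = Ψ △ {p, c₀p, q, c₀q}`.  Pointwise `𝟙_{Ψ_v} + 𝟙_{Ψ_{abv}} = 𝟙_{Ψ_{av}} + 𝟙_{Ψ_{bv}}`, so the FOUR-POINT SET
`D = {(1,1), (1,ab), (c₀,a), (c₀,b)}` is BALANCED (`#{d ∈ D : d g ∈ Φ} = 2` for every `g`) and moved by `c` — the type
is DEGENERATE; and it is PRIMITIVE as soon as `Ψ` is primitive in `H` and no involution `y` of `H` (nor `y = 1`) maps
`Ψ` onto `Ψ_a`, `Ψ_b` or `Ψ_{ab}` (a stabilising `(y, v₀)`, `v₀ ≠ 1`, has `(y², 1)` stabilising, so `y² = 1`).  When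
`c₀` is the ONLY involution of `H` (generalized quaternion, dicyclic, `C_m ⋊ C_{2^k}`, …) this rigidity is automatic
for `|H| ≥ 8` (`c₀Ψ = H ∖ Ψ` differs from `Ψ` in `|H|` points, the swaps in at most `4`).

* §1 `exists_simple_degenerate_of_model_kleinFour` — the abstract theorem on a model `H × (C₂ × C₂)` (families
  `Ψ : V → Finset H` with the pointwise sum identity, `Ψ 1` primitive, rigidity under involutions).
* §2 **`exists_simple_degenerate_of_quaternion_kleinFour`** — `Gal(K/ℚ) ≅ Q_{4n} × C₂ × C₂` (Mathlib
  `QuaternionGroup n`, `n ≥ 2`, `c = (aⁿ, 1)`; `Q_{4n} = Dic_n`): a SIMPLE DEGENERATE abelian variety of dimension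
  `8n` with CM by `K` (the double interval `{aⁱ, xaⁱ : i < n}` swapped at `xa⁰` and `xa¹`).  CONTRAST: `Q_{2^{k+2}} ×
      C₂`
  with `c` in the quaternion factor is GOOD (gen 20 `GaloisDicyclic.…quaternion_times_two`; `Q₈ × C₂`, gen 16): one real
  quadratic factor is harmless for the generalized quaternion fields, a real biquadratic factor is fatal.  `Q₈ × C₂²`
  (order 32) has no core-free subgroup, hence no skew set (part I): this badness is invisible to parts I–VI.
Consistent with the abelian classification (gens 15–18): `C_{2^k} × C₂²` (`k ≥ 3`), `(C₄ × C₂) × C₂²`, `C₂³ × C₂²` are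
bad while `C₄ × C₂²` (`c` a square) and `C₂² × C₂²` — `|H| = 4` — are the sporadic good classes.

## References

* [Shimura1998] G. Shimura, *Abelian Varieties with Complex Multiplication and Modular Functions*, §6.2 Thm. 3,
  §8.2 Prop. 26, §18.2 Lemma (i).
* [Gordon1999HodgeAVSurvey] B. B. Gordon, *A survey of the Hodge conjecture for abelian varieties*, Thm. 6.4, §9.3.
-/

noncomputable section

open CategoryTheory CategoryTheory.Limits NumberField
open scoped BigOperators

namespace Summit.HodgeConjecture.CorCM.GaloisModels

open Literature.NumberTheory.ComplexMultiplication
open Literature.AlgebraicGeometry.Motives (AbelianVariety CMType)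
open Literature.AlgebraicGeometry.HodgeTheory
open Literature.AlgebraicGeometry.ComplexMultiplication (IsCMTypeRealisation)
open Literature.AlgebraicGeometry.Pohlmann1968
open Literature.Barriers.HodgeConjecture (divisorClassesSpan)
open Summit.HodgeConjecture.CorCM.CyclicAsymmetricHalves

/-! ## §1 The double pair swap on `H × (C₂ × C₂)` -/

section KleinFour

variable {H : Type*} [Group H] [Fintype H] [DecidableEq H]

/-- The four elements of `C₂ × C₂`. [folklore] -/
theorem kleinFour_cases (v : (Multiplicative (ZMod 2) × Multiplicative (ZMod 2))) :
    v = 1 ∨ v = (Multiplicative.ofAdd 1, 1) ∨ v = (1, Multiplicative.ofAdd 1) ∨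
      v = (Multiplicative.ofAdd 1, Multiplicative.ofAdd 1) := by
  revert v; decide

/-- Counting lemma: if `[A] + [B] = [¬C] + [¬D]` (as multisets of truth values) then
`2·([A] + [B] + [C] + [D]) = 4`. [folklore] -/
theorem two_mul_ite_add_eq_four (A B C D : Prop) [Decidable A] [Decidable B] [Decidable C] [Decidable D]
    (h : ((A ∧ B) ↔ (¬ C ∧ ¬ D)) ∧ ((A ∨ B) ↔ (¬ C ∨ ¬ D))) :
    2 * ((if A then 1 else 0) + ((if B then 1 else 0) + ((if C then 1 else 0) + (if D then 1 else 0)))) = 4 := by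
  by_cases hA : A <;> by_cases hB : B <;> by_cases hC : C <;> by_cases hD : D <;> simp_all

omit [Fintype H] in
/-- **The four-point set `{(1,1), (1,ab), (c₀,a), (c₀,b)}` is BALANCED** for the family type `{(x,v) : x ∈ Ψ v}` as
soon as `𝟙_{Ψ v} + 𝟙_{Ψ (ab v)} = 𝟙_{Ψ (a v)} + 𝟙_{Ψ (b v)}` pointwise and each `Ψ v` is a CM set for `c₀`.
[cite: Gordon1999HodgeAVSurvey, §9.3] -/
theorem kleinFour_balanced (c₀ : H) (Ψ : (Multiplicative (ZMod 2) × Multiplicative (ZMod 2)) → Finset H)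
    (hcm : ∀ v x, x ∈ Ψ v ↔ c₀ * x ∉ Ψ v)
    (hbal : ∀ v x, ((x ∈ Ψ v ∧ x ∈ Ψ ((Multiplicative.ofAdd 1, Multiplicative.ofAdd 1) * v)) ↔
        (x ∈ Ψ ((Multiplicative.ofAdd 1, 1) * v) ∧ x ∈ Ψ ((1, Multiplicative.ofAdd 1) * v))) ∧
      ((x ∈ Ψ v ∨ x ∈ Ψ ((Multiplicative.ofAdd 1, Multiplicative.ofAdd 1) * v)) ↔
        (x ∈ Ψ ((Multiplicative.ofAdd 1, 1) * v) ∨ x ∈ Ψ ((1, Multiplicative.ofAdd 1) * v))))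
    {T : Finset (H × (Multiplicative (ZMod 2) × Multiplicative (ZMod 2)))} (hT : ∀ p : H × (Multiplicative (ZMod 2) ×
        Multiplicative (ZMod 2)), p ∈ T ↔ p.1 ∈ Ψ p.2) (g : H × (Multiplicative (ZMod 2) × Multiplicative (ZMod 2))) :
    2 * (({((1 : H), (1 : (Multiplicative (ZMod 2) × Multiplicative (ZMod 2)))), ((1 : H), ((Multiplicative.ofAdd 1,
        Multiplicative.ofAdd 1) : (Multiplicative (ZMod 2) × Multiplicative (ZMod 2)))),
        (c₀, ((Multiplicative.ofAdd 1, 1) : (Multiplicative (ZMod 2) × Multiplicative (ZMod 2)))), (c₀, ((1,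
            Multiplicative.ofAdd 1) : (Multiplicative (ZMod 2) × Multiplicative (ZMod 2))))} :
        Finset (H × (Multiplicative (ZMod 2) × Multiplicative (ZMod 2)))).filter fun d => d * g ∈ T).card = 4 := by
  obtain ⟨x, v⟩ := g
  have hn1 : ((1 : H), (1 : (Multiplicative (ZMod 2) × Multiplicative (ZMod 2)))) ∉ ({((1 : H),
      ((Multiplicative.ofAdd 1, Multiplicative.ofAdd 1) : (Multiplicative (ZMod 2) × Multiplicative (ZMod 2)))),
      (c₀, ((Multiplicative.ofAdd 1, 1) : (Multiplicative (ZMod 2) × Multiplicative (ZMod 2)))), (c₀, ((1,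
          Multiplicative.ofAdd 1) : (Multiplicative (ZMod 2) × Multiplicative (ZMod 2))))} : Finset (H ×
          (Multiplicative (ZMod 2) × Multiplicative (ZMod 2)))) := by
    simp only [Finset.mem_insert, Finset.mem_singleton, Prod.mk.injEq, not_or]
    refine ⟨fun h => ?_, fun h => ?_, fun h => ?_⟩ <;> exact absurd h.2 (by decide)
  have hn2 : ((1 : H), ((Multiplicative.ofAdd 1, Multiplicative.ofAdd 1) : (Multiplicative (ZMod 2) × Multiplicative
      (ZMod 2)))) ∉
      ({(c₀, ((Multiplicative.ofAdd 1, 1) : (Multiplicative (ZMod 2) × Multiplicative (ZMod 2)))), (c₀, ((1,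
          Multiplicative.ofAdd 1) : (Multiplicative (ZMod 2) × Multiplicative (ZMod 2))))} : Finset (H ×
          (Multiplicative (ZMod 2) × Multiplicative (ZMod 2)))) := by
    simp only [Finset.mem_insert, Finset.mem_singleton, Prod.mk.injEq, not_or]
    refine ⟨fun h => ?_, fun h => ?_⟩ <;> exact absurd h.2 (by decide)
  have hn3 : (c₀, ((Multiplicative.ofAdd 1, 1) : (Multiplicative (ZMod 2) × Multiplicative (ZMod 2)))) ∉
      ({(c₀, ((1, Multiplicative.ofAdd 1) : (Multiplicative (ZMod 2) × Multiplicative (ZMod 2))))} : Finset (H ×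
          (Multiplicative (ZMod 2) × Multiplicative (ZMod 2)))) := by
    simp only [Finset.mem_singleton, Prod.mk.injEq, not_and]
    exact fun _ h => absurd h (by decide)
  rw [Finset.card_filter, Finset.sum_insert hn1, Finset.sum_insert hn2, Finset.sum_insert hn3, Finset.sum_singleton]
  simp only [Prod.mk_mul_mk, one_mul, hT]
  have hA := hbal v x
  rw [hcm ((Multiplicative.ofAdd 1, 1) * v) x, hcm ((1, Multiplicative.ofAdd 1) * v) x] at hA
  exact two_mul_ite_add_eq_four _ _ _ _ hA

/-- **TRIVIAL LEFT STABILISER of the family type** when `Ψ 1` is primitive in `H` and RIGID: no `y` with `y² = 1`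
maps `Ψ 1` onto `Ψ v` for `v ≠ 1` (a stabilising `(y, v₀)` with `v₀ ≠ 1` has `(y², 1)` stabilising, so `y² = 1`).
[cite: Shimura1998, §8.2 Prop. 26] -/
theorem kleinFour_leftStabiliser (Ψ : (Multiplicative (ZMod 2) × Multiplicative (ZMod 2)) → Finset H)
    (hprim : ∀ y : H, y ≠ 1 → ∃ w : H, ¬ (w ∈ Ψ 1 ↔ y * w ∈ Ψ 1))
    (hrig : ∀ y : H, y * y = 1 → ∀ v : (Multiplicative (ZMod 2) × Multiplicative (ZMod 2)), v ≠ 1 → ∃ w : H, ¬ (w ∈ Ψ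
        1 ↔ y * w ∈ Ψ v))
    {T : Finset (H × (Multiplicative (ZMod 2) × Multiplicative (ZMod 2)))} (hT : ∀ p : H × (Multiplicative (ZMod 2) ×
        Multiplicative (ZMod 2)), p ∈ T ↔ p.1 ∈ Ψ p.2) (g : H × (Multiplicative (ZMod 2) × Multiplicative (ZMod 2)))
        (hg : g ≠ 1) :
    ∃ w : H × (Multiplicative (ZMod 2) × Multiplicative (ZMod 2)), ¬ (w ∈ T ↔ g * w ∈ T) := by
  obtain ⟨y, v₀⟩ := g
  by_contra hall
  push Not at hall
  have hrow : ∀ x : H, x ∈ Ψ 1 ↔ y * x ∈ Ψ v₀ := fun x => by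
    have := hall (x, 1)
    rwa [hT, hT, Prod.mk_mul_mk, mul_one] at this
  by_cases hv : v₀ = 1
  · subst hv
    have hy : y ≠ 1 := fun h1 => hg (by rw [h1]; rfl)
    obtain ⟨w, hw⟩ := hprim y hy
    exact hw (hrow w)
  · -- `(y², 1)` stabilises, so `y² = 1`
    have hyy : y * y = 1 := by
      by_contra hne
      obtain ⟨w, hw⟩ := hprim (y * y) hne
      apply hw
      have h1 := hall (w, 1)
      have h2 := hall (y * w, v₀)
      rw [hT, hT, Prod.mk_mul_mk, mul_one] at h1
      rw [hT, hT, Prod.mk_mul_mk] at h2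
      have hvv : v₀ * v₀ = 1 := by
        have : ∀ u : (Multiplicative (ZMod 2) × Multiplicative (ZMod 2)), u * u = 1 := by decide
        exact this v₀
      rw [hvv, ← mul_assoc] at h2
      exact h1.trans h2
    obtain ⟨w, hw⟩ := hrig y hyy v₀ hv
    exact hw (hrow w)

variable {K : Type} [Field K] [NumberField K] [IsCMField K] [IsGalois ℚ K]

/-- **THEOREM (Klein four-group factor, abstract form).**  `K` Galois CM, `e : Gal(K/ℚ) ≃* H × (C₂ × C₂)` with
`e(c) = (c₀, 1)`, and CM sets `Ψ v ⊆ H` (`v ∈ C₂ × C₂`) with `𝟙_{Ψ v} + 𝟙_{Ψ(ab v)} = 𝟙_{Ψ(a v)} + 𝟙_{Ψ(b v)}`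
pointwise, `Ψ 1` primitive in `H`, and no `y` with `y² = 1` mapping `Ψ 1` onto another `Ψ v`.  Then `K` has a SIMPLE
DEGENERATE abelian variety of dimension `2|H|` with CM by `K`, with an exceptional Hodge class on some power — by the
four-point balanced set `{(1,1), (1,ab), (c₀,a), (c₀,b)}`. [cite: Shimura1998, §6.2 Thm. 3 and §8.2 Prop. 26]
[cite: Gordon1999HodgeAVSurvey, Thm. 6.4 and §9.3] -/
theorem exists_simple_degenerate_of_model_kleinFour (e : (K ≃ₐ[ℚ] K) ≃* H × (Multiplicative (ZMod 2) × Multiplicative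
    (ZMod 2))) (c₀ : H)
    (hc : e ((IsCMField.complexConj K).restrictScalars ℚ) = (c₀, 1)) (Ψ : (Multiplicative (ZMod 2) × Multiplicative
        (ZMod 2)) → Finset H)
    (hcm : ∀ v x, x ∈ Ψ v ↔ c₀ * x ∉ Ψ v)
    (hbal : ∀ v x, ((x ∈ Ψ v ∧ x ∈ Ψ ((Multiplicative.ofAdd 1, Multiplicative.ofAdd 1) * v)) ↔
        (x ∈ Ψ ((Multiplicative.ofAdd 1, 1) * v) ∧ x ∈ Ψ ((1, Multiplicative.ofAdd 1) * v))) ∧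
      ((x ∈ Ψ v ∨ x ∈ Ψ ((Multiplicative.ofAdd 1, Multiplicative.ofAdd 1) * v)) ↔
        (x ∈ Ψ ((Multiplicative.ofAdd 1, 1) * v) ∨ x ∈ Ψ ((1, Multiplicative.ofAdd 1) * v))))
    (hprim : ∀ y : H, y ≠ 1 → ∃ w : H, ¬ (w ∈ Ψ 1 ↔ y * w ∈ Ψ 1))
    (hrig : ∀ y : H, y * y = 1 → ∀ v : (Multiplicative (ZMod 2) × Multiplicative (ZMod 2)), v ≠ 1 → ∃ w : H, ¬ (w ∈ Ψ
        1 ↔ y * w ∈ Ψ v)) :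
    ∃ (Φ : CMType K) (φ₀ : K →+* ℂ) (A : AbelianVariety ℂ) (ι : 𝓞 K →+* End A)
      (θ : K →+* Module.End ℂ (complexBetti A.X 1)),
      IsPrimitive (ℂ ≃+* ℂ) Φ.1 φ₀ ∧ ¬ IsNondegenerate Φ ∧ IsCMTypeRealisation Φ A ι θ ∧ A.IsSimple ∧
      A.dim = 2 * Fintype.card H ∧
      ∃ n p : ℕ, ∃ x : complexBetti (⨁ fun _ : Fin n => A).X (2 * p), IsRationalClass x ∧
        IsOfHodgeType (⨁ fun _ : Fin n => A).dim (⨁ fun _ : Fin n => A).X (2 * p) p p x ∧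
        x ∉ divisorClassesSpan (⨁ fun _ : Fin n => A).X (⨁ fun _ : Fin n => A).dim p := by
  classical
  set T : Finset (H × (Multiplicative (ZMod 2) × Multiplicative (ZMod 2))) := Finset.univ.filter fun p => p.1 ∈ Ψ p.2
      with hT_def
  have hT : ∀ p : H × (Multiplicative (ZMod 2) × Multiplicative (ZMod 2)), p ∈ T ↔ p.1 ∈ Ψ p.2 := fun p => by simp
      [hT_def]
  have hc1 : c₀ ≠ 1 := fun h1 => GaloisRank.model_complexConj_ne_one e hc (by rw [h1]; rfl)
  have hmain := exists_simple_degenerate_of_model_balanced e (c₀, 1) hc T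
    (fun p => by
      obtain ⟨x, v⟩ := p
      rw [hT, hT, Prod.mk_mul_mk, one_mul]
      exact hcm v x)
    (kleinFour_leftStabiliser Ψ hprim hrig hT)
    {((1 : H), (1 : (Multiplicative (ZMod 2) × Multiplicative (ZMod 2)))), ((1 : H), ((Multiplicative.ofAdd 1,
        Multiplicative.ofAdd 1) : (Multiplicative (ZMod 2) × Multiplicative (ZMod 2)))),
      (c₀, ((Multiplicative.ofAdd 1, 1) : (Multiplicative (ZMod 2) × Multiplicative (ZMod 2)))), (c₀, ((1,
          Multiplicative.ofAdd 1) : (Multiplicative (ZMod 2) × Multiplicative (ZMod 2))))}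
    (fun g => by
      rw [kleinFour_balanced c₀ Ψ hcm hbal hT g]
      -- `#D = 4`
      rw [Finset.card_insert_of_notMem, Finset.card_insert_of_notMem, Finset.card_insert_of_notMem,
        Finset.card_singleton]
      · simp only [Finset.mem_singleton, Prod.mk.injEq, not_and]
        exact fun _ h => absurd h (by decide)
      · simp only [Finset.mem_insert, Finset.mem_singleton, Prod.mk.injEq, not_or]
        refine ⟨fun h => ?_, fun h => ?_⟩ <;> exact absurd h.2 (by decide)
      · simp only [Finset.mem_insert, Finset.mem_singleton, Prod.mk.injEq, not_or]
        refine ⟨fun h => ?_, fun h => ?_, fun h => ?_⟩ <;> exact absurd h.2 (by decide))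
    ⟨((1 : H), (1 : (Multiplicative (ZMod 2) × Multiplicative (ZMod 2)))), by simp, by
      rw [Prod.mk_mul_mk, mul_one, mul_one]
      simp only [Finset.mem_insert, Finset.mem_singleton, Prod.mk.injEq, not_or]
      exact ⟨fun h => hc1 h.1, fun h => absurd h.2 (by decide), fun h => absurd h.2 (by decide),
        fun h => absurd h.2 (by decide)⟩⟩
  rwa [Fintype.card_prod, show Fintype.card (Multiplicative (ZMod 2) × Multiplicative (ZMod 2)) = 4 by rfl, show
      Fintype.card H * 4 / 2 = 2 * Fintype.card H by
    omega] at hmain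

end KleinFour

/-! ## §2 The double pair swap `Ψ₀ △ E_v` and the unique-involution theorem -/

section PairSwap

variable {H : Type*} [Group H] [DecidableEq H]

/-- In `C₂`: `z t = 1 ↔ t ≠ 1`. [folklore] -/
theorem ofAdd_one_mul_eq_one_iff (t : Multiplicative (ZMod 2)) :
    Multiplicative.ofAdd (1 : ZMod 2) * t = 1 ↔ ¬ t = 1 := by
  revert t; decide

omit [Group H] in
/-- Membership in the swap set `E_v = (P̂ if v₁ ≠ 1) ∪ (Q̂ if v₂ ≠ 1)`. [folklore] -/
theorem mem_swapSet (P Q : Finset H) (v : (Multiplicative (ZMod 2) × Multiplicative (ZMod 2))) (x : H) :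
    x ∈ ((if v.1 = 1 then (∅ : Finset H) else P) ∪ (if v.2 = 1 then (∅ : Finset H) else Q)) ↔
      (¬ v.1 = 1 ∧ x ∈ P) ∨ (¬ v.2 = 1 ∧ x ∈ Q) := by
  rw [Finset.mem_union]
  split_ifs with h1 h2 h2 <;> simp [h1, h2]

/-- Propositional core of the balance identity for the swapped family. [folklore] -/
theorem pairSwap_prop (A α β π κ : Prop) (hdis : ¬ (π ∧ κ)) :
    (((A ↔ ¬ ((¬ α ∧ π) ∨ (¬ β ∧ κ))) ∧ (A ↔ ¬ ((¬ ¬ α ∧ π) ∨ (¬ ¬ β ∧ κ)))) ↔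
      ((A ↔ ¬ ((¬ ¬ α ∧ π) ∨ (¬ β ∧ κ))) ∧ (A ↔ ¬ ((¬ α ∧ π) ∨ (¬ ¬ β ∧ κ))))) ∧
    (((A ↔ ¬ ((¬ α ∧ π) ∨ (¬ β ∧ κ))) ∨ (A ↔ ¬ ((¬ ¬ α ∧ π) ∨ (¬ ¬ β ∧ κ)))) ↔
      ((A ↔ ¬ ((¬ ¬ α ∧ π) ∨ (¬ β ∧ κ))) ∨ (A ↔ ¬ ((¬ α ∧ π) ∨ (¬ ¬ β ∧ κ))))) := by
  by_cases hA : A <;> by_cases hα : α <;> by_cases hβ : β <;> by_cases hπ : π <;> by_cases hκ : κ <;>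
    simp_all

/-- Propositional core of the CM property of `Ψ₀ △ E` (`E` stable under `c₀`). [folklore] -/
theorem symmDiff_cm_prop (A e : Prop) : (A ↔ ¬ e) ↔ ¬ (¬ A ↔ ¬ e) := by
  by_cases hA : A <;> by_cases he : e <;> simp_all

variable [Fintype H]
variable {K : Type} [Field K] [NumberField K] [IsCMField K] [IsGalois ℚ K]

/-- **THEOREM (Klein four-group factor, unique involution).**  `K` Galois CM, `e : Gal(K/ℚ) ≃* H × (C₂ × C₂)` with
`e(c) = (c₀, 1)`, where `c₀` is the ONLY involution of `H` and `|H| > 4`; `Ψ₀ ⊆ H` a CM set for `c₀` with trivial left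
stabiliser (a primitive CM type of `K₁ = K^{1 × C₂²}`), and `p, q ∈ H` in different `c₀`-pairs.  Then `K` has a SIMPLE
DEGENERATE abelian variety of dimension `2|H|` with CM by `K`, with an exceptional Hodge class on some power: the
double pair swap `Ψ_v = Ψ₀ △ E_v` is primitive (an involution stabiliser would be `c₀`, which moves every point of
`Ψ₀`) and balanced by the four-point set `{(1,1), (1,ab), (c₀,a), (c₀,b)}`. [cite: Shimura1998, §6.2 Thm. 3 and
§8.2 Prop. 26] [cite: Gordon1999HodgeAVSurvey, Thm. 6.4 and §9.3] -/
theorem exists_simple_degenerate_of_model_kleinFour_uniqueInvolution (e : (K ≃ₐ[ℚ] K) ≃* H × (Multiplicative (ZMod 2)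
    × Multiplicative (ZMod 2))) (c₀ : H)
    (hc : e ((IsCMField.complexConj K).restrictScalars ℚ) = (c₀, 1))
    (huniq : ∀ y : H, y * y = 1 → y = 1 ∨ y = c₀) (hcard : 4 < Fintype.card H) (Ψ₀ : Finset H)
    (hcm₀ : ∀ x, x ∈ Ψ₀ ↔ c₀ * x ∉ Ψ₀) (hprim₀ : ∀ y : H, y ≠ 1 → ∃ w : H, ¬ (w ∈ Ψ₀ ↔ y * w ∈ Ψ₀))
    (p q : H) (hpq : q ≠ p ∧ q ≠ c₀ * p) :
    ∃ (Φ : CMType K) (φ₀ : K →+* ℂ) (A : AbelianVariety ℂ) (ι : 𝓞 K →+* End A)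
      (θ : K →+* Module.End ℂ (complexBetti A.X 1)),
      IsPrimitive (ℂ ≃+* ℂ) Φ.1 φ₀ ∧ ¬ IsNondegenerate Φ ∧ IsCMTypeRealisation Φ A ι θ ∧ A.IsSimple ∧
      A.dim = 2 * Fintype.card H ∧
      ∃ n p : ℕ, ∃ x : complexBetti (⨁ fun _ : Fin n => A).X (2 * p), IsRationalClass x ∧
        IsOfHodgeType (⨁ fun _ : Fin n => A).dim (⨁ fun _ : Fin n => A).X (2 * p) p p x ∧
        x ∉ divisorClassesSpan (⨁ fun _ : Fin n => A).X (⨁ fun _ : Fin n => A).dim p := by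
  classical
  have hcc : c₀ * c₀ = 1 := by
    have := GaloisRank.model_complexConj_mul_self e hc
    rw [Prod.mk_mul_mk, mul_one, Prod.mk_eq_one] at this
    exact this.1
  have hc1 : c₀ ≠ 1 := fun h1 => GaloisRank.model_complexConj_ne_one e hc (by rw [h1]; rfl)
  -- the pairs and the swapped family
  set P : Finset H := {p, c₀ * p} with hP
  set Q : Finset H := {q, c₀ * q} with hQ
  have hPc : ∀ x, x ∈ P ↔ c₀ * x ∈ P := fun x => by
    simp only [hP, Finset.mem_insert, Finset.mem_singleton]
    constructor
    · rintro (rfl | rfl)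
      · exact Or.inr rfl
      · left; rw [← mul_assoc, hcc, one_mul]
    · rintro (h | h)
      · right; rw [← h, ← mul_assoc, hcc, one_mul]
      · left; exact mul_left_cancel h
  have hQc : ∀ x, x ∈ Q ↔ c₀ * x ∈ Q := fun x => by
    simp only [hQ, Finset.mem_insert, Finset.mem_singleton]
    constructor
    · rintro (rfl | rfl)
      · exact Or.inr rfl
      · left; rw [← mul_assoc, hcc, one_mul]
    · rintro (h | h)
      · right; rw [← h, ← mul_assoc, hcc, one_mul]
      · left; exact mul_left_cancel h
  have hdis : ∀ x, ¬ (x ∈ P ∧ x ∈ Q) := fun x ⟨hxP, hxQ⟩ => by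
    simp only [hP, hQ, Finset.mem_insert, Finset.mem_singleton] at hxP hxQ
    rcases hxP with h1 | h1 <;> rcases hxQ with h2 | h2
    · exact hpq.1 (h2.symm.trans h1)
    · exact hpq.2 (by rw [← h1, h2, ← mul_assoc, hcc, one_mul])
    · exact hpq.2 (h2.symm.trans h1)
    · exact hpq.1 (mul_left_cancel (h2.symm.trans h1))
  let E : (Multiplicative (ZMod 2) × Multiplicative (ZMod 2)) → Finset H := fun v => (if v.1 = 1 then (∅ : Finset H)
      else P) ∪ (if v.2 = 1 then (∅ : Finset H) else Q)
  have hE : ∀ v x, x ∈ E v ↔ (¬ v.1 = 1 ∧ x ∈ P) ∨ (¬ v.2 = 1 ∧ x ∈ Q) := fun v x => mem_swapSet P Q v x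
  have hEc : ∀ v x, x ∈ E v ↔ c₀ * x ∈ E v := fun v x => by rw [hE, hE, ← hPc, ← hQc]
  have hEsub : ∀ v x, x ∈ E v → x ∈ P ∨ x ∈ Q := fun v x hx => by
    rcases (hE v x).1 hx with ⟨-, h⟩ | ⟨-, h⟩
    · exact Or.inl h
    · exact Or.inr h
  let Ψ : (Multiplicative (ZMod 2) × Multiplicative (ZMod 2)) → Finset H := fun v => symmDiff Ψ₀ (E v)
  have hΨ : ∀ v x, x ∈ Ψ v ↔ (x ∈ Ψ₀ ↔ x ∉ E v) := fun v x => by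
    change x ∈ symmDiff Ψ₀ (E v) ↔ _
    rw [Finset.mem_symmDiff]
    tauto
  have hΨ1 : ∀ x, x ∈ Ψ 1 ↔ x ∈ Ψ₀ := fun x => by
    rw [hΨ, hE]
    simp
  -- the three hypotheses of §1
  have hcmΨ : ∀ v x, x ∈ Ψ v ↔ c₀ * x ∉ Ψ v := fun v x => by
    rw [hΨ, hΨ, hcm₀ x, ← hEc v x]
    exact symmDiff_cm_prop (c₀ * x ∈ Ψ₀) (x ∈ E v) |> fun h => by
      constructor
      · intro h1 h2; exact (h.1 (by tauto)) (by tauto)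
      · intro h1; by_contra h3; exact h1 (by tauto)
  have z1 : ∀ t : Multiplicative (ZMod 2), (Multiplicative.ofAdd (1 : ZMod 2) * t = 1) = (¬ t = 1) := fun t =>
    propext (ofAdd_one_mul_eq_one_iff t)
  have hbalΨ : ∀ v x, ((x ∈ Ψ v ∧ x ∈ Ψ ((Multiplicative.ofAdd 1, Multiplicative.ofAdd 1) * v)) ↔
        (x ∈ Ψ ((Multiplicative.ofAdd 1, 1) * v) ∧ x ∈ Ψ ((1, Multiplicative.ofAdd 1) * v))) ∧
      ((x ∈ Ψ v ∨ x ∈ Ψ ((Multiplicative.ofAdd 1, Multiplicative.ofAdd 1) * v)) ↔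
        (x ∈ Ψ ((Multiplicative.ofAdd 1, 1) * v) ∨ x ∈ Ψ ((1, Multiplicative.ofAdd 1) * v))) := fun v x => by
    simp only [hΨ, hE, Prod.fst_mul, Prod.snd_mul, one_mul, z1]
    exact pairSwap_prop (x ∈ Ψ₀) (v.1 = 1) (v.2 = 1) (x ∈ P) (x ∈ Q) (hdis x)
  have hprimΨ : ∀ y : H, y ≠ 1 → ∃ w : H, ¬ (w ∈ Ψ 1 ↔ y * w ∈ Ψ 1) := fun y hy => by
    obtain ⟨w, hw⟩ := hprim₀ y hy
    exact ⟨w, by rwa [hΨ1, hΨ1]⟩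
  have hrigΨ : ∀ y : H, y * y = 1 → ∀ v : (Multiplicative (ZMod 2) × Multiplicative (ZMod 2)), v ≠ 1 → ∃ w : H, ¬ (w
      ∈ Ψ 1 ↔ y * w ∈ Ψ v) := by
    intro y hyy v hv
    rcases huniq y hyy with hy1 | hyc
    · -- `y = 1`: a point of `E v ≠ ∅`
      subst hy1
      have hne : ∃ w, w ∈ E v := by
        by_cases h1 : v.1 = 1
        · have h2 : ¬ v.2 = 1 := fun h2 => hv (Prod.ext h1 h2)
          exact ⟨q, (hE v q).2 (Or.inr ⟨h2, by simp [hQ]⟩)⟩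
        · exact ⟨p, (hE v p).2 (Or.inl ⟨h1, by simp [hP]⟩)⟩
      obtain ⟨w, hw⟩ := hne
      refine ⟨w, fun hiff => ?_⟩
      rw [hΨ1, one_mul, hΨ] at hiff
      tauto
    · -- `y = c₀`: a point outside `P ∪ Q`
      rw [hyc]
      have hne : ∃ w, w ∉ P ∪ Q := by
        by_contra hall
        push Not at hall
        have hsub : (Finset.univ : Finset H) ⊆ P ∪ Q := fun w _ => hall w
        have h1 := Finset.card_le_card hsub
        have h2 : (P ∪ Q).card ≤ 4 := (Finset.card_union_le P Q).trans (by
          have hp2 : P.card ≤ 2 := Finset.card_le_two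
          have hq2 : Q.card ≤ 2 := Finset.card_le_two
          omega)
        rw [Finset.card_univ] at h1
        omega
      obtain ⟨w, hw⟩ := hne
      rw [Finset.mem_union, not_or] at hw
      have hwE : c₀ * w ∉ E v := fun h => by
        rcases hEsub v w ((hEc v w).2 h) with h' | h'
        · exact hw.1 h'
        · exact hw.2 h'
      refine ⟨w, fun hiff => ?_⟩
      rw [hΨ1, hΨ] at hiff
      have h3 := hcm₀ w
      tauto
  have hmain := exists_simple_degenerate_of_model_kleinFour e c₀ hc Ψ hcmΨ hbalΨ hprimΨ hrigΨ
  exact hmain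

end PairSwap

end Summit.HodgeConjecture.CorCM.GaloisModels

end
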